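import Summits.BirchSwinnertonDyer.BirchSwinnertonDyer.Theses.GenusKolyvaginAtTwo
import Summits.BirchSwinnertonDyer.BirchSwinnertonDyer.Theses.ByReductionTypeAtTwo
import Summits.BirchSwinnertonDyer.BirchSwinnertonDyer.Theorems.GenusKolyvaginAtTwoK4PosTwinBsdRoadNonPhantomAtTwo
import Summits.BirchSwinnertonDyer.BirchSwinnertonDyer.Theorems.GenusKolyvaginAtTwoGenusPrimitiveSupplyAtTwoPosDiscShallowKFourPosLeafCurrency
import Summits.BirchSwinnertonDyer.BirchSwinnertonDyer.Theorems.GenusKolyvaginAtTwoShaRatCardOfKFour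
import Summits.BirchSwinnertonDyer.BirchSwinnertonDyer.Theorems.GenusKolyvaginAtTwoGenusPrimitiveSupplyAtTwoPosDiscShallowKFourPosHalvingDescentCorollaries
import Summits.BirchSwinnertonDyer.BirchSwinnertonDyer.Theorems.GenusKolyvaginAtTwoMinimalTwinBSDTwoSwappedPairFrame
import Summits.BirchSwinnertonDyer.BirchSwinnertonDyer.Theorems.GenusKolyvaginAtTwoGenusPrimitiveSupplyAtTwoPosDiscShallowOfKernelsMixed
import Summits.BirchSwinnertonDyer.BirchSwinnertonDyer.Theorems.GenusKolyvaginAtTwoSupplyKernelsLossless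
import Literature.NumberTheory.EllipticCurves.HeegnerPointsKolyvaginExceptionalTwistProofs
import Literature.NumberTheory.EllipticCurves.BSDRootNumberSmallConductorProofs
import HarnessLib

/-!
# Route `GenusKolyvaginAtTwo`: THE `Δ > 0` SUPPLY CRUX `GenusPrimitiveSupplyAtTwoPosDiscShallow` (stmt-BirchSwinnertonDyer-25504, rank 2, binder
# `hP` of `closes`) BY NAME from EXISTING ITEMS ONLY — WALL row 1 + U₂ + Q2 + the rank-one 2-converse items + PRINT; no K-item

Seat `bsd-line-gk2-p2` g28 (PROVER seat 2/3, cell `bsd-f1-sign2`; LINE 23 holder on U₂), `--supports stmt-BirchSwinnertonDyer-25504` (helper;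
closes nothing — every antecedent is an OPEN or print route item).  THEOREMS ONLY (no definition, no named fact, no `sorry`); standard axioms.
**BSD is NOT proved by this file; 25504, K4Pos, K1Pos, U₂, Q2, the WALL rows and the 2-converse items are NOT proved; no item is closed.**

THE POINT (the `Δ > 0` twin of LEAD gk2-p1 g29's «23491 END-TO-END» assembly).  The route pen's LINE 33 v1.5 (`Cruxes/K4Pos/Lines/twin_bsd_road.lean`,
ideator `bsd-idea-1` g27) carries a SORRY-FREE road `K4Pos_of_wall_U2_nonPhantom : WALL rows → U₂ → Q2 → PRINT → K4Pos` (on the cut the LEAD's leaf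
currency `PlusDescent.kFourPos_conclusion_iff_bsdp`; off the cut the pair ledger `GenusSupplyNarrow.Lossless.…_eq_pow_of_bsdp_pair` + the LEAD's sharp
class `PlusDescent.exists_mem_sha_two_pow_pred_smul_ne_zero_of_natCard_eq_pow` + the master `…exists_transpositionDeep_primitive_…_of_nonPhantom`, with
(NPh_K) DISCHARGED by gk2-p4 g32's real witness `Lw2PhantomExclusion.RealWitness.offCutNonPhantomAtTwo_of_twoSplit`).  A line file is not importable
by the route's Theorems; §1 is its THEOREMS-SIDE PORT (proofs verbatim up to names), so that the by-name closer of the supply crux can be stated: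

* §1 ★ `k4Pos_of_wallItems_of_minimalTwinBSDTwo_of_kolyvaginRelation` — **K4Pos (31469) ⟸ WALL rows 19095–19098 + U₂ (22985) + Q2 (24880) +
  GZ/GZK/L/Milne**, BY NAME (port of the pen's v1.5 road);
* §2 ★★ `genusPrimitiveSupplyAtTwoPosDiscShallow_of_items_of_wall_U2_Q2` — **25504 ⟸ `GrossZagierAllLevels` (24148) + `ModularityExistsNewform`
  (19382) + `TwoParityDD` (23327) + `RankOneTwoConverse` (19220) + `RankOneTwoConverseOffSemistableAtTwo` (24948) + WALL rows + U₂ + Q2 +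
  `MultPublishedInputsAtTwo` (19921) + `EntireLFunctionRat` (19273) + `MilneAnyModel` (24149)**, BY NAME: gk2-p2's mixed-frame itemisation
  `GenusSupplyPos.PrimeFrame.genusPrimitiveSupplyAtTwoPosDiscShallow_of_items_of_selmerSplit_mixed` (p766811) fed with K1Pos from
  `Lossless.OfWallU2.k1Pos_of_wallItems_of_minimalTwinBSDTwo` (this seat, p791715; re-derived in §2 along a route-independent import chain) and K4Pos from §1.

READING (census).  The `Δ > 0` supply crux has NO private content modulo the route's other items: its K-kernels are the wall (rank-`0` BSD₂ of the
habitat curve), U₂ (BSD₂ of the twin), Q2 (Gross–McCallum local relation at `2`) and the rank-one `2`-converse (to certify `r_an = 1` for the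
Mazur–Rubin twin) — every one of them an EXISTING item of this or a sibling route.  Inside `closes` this is NOT a shortcut (there BSD₂ of the
habitat curve is the output).  Nothing here is progress on BSD.

References: [Kolyvagin1989Izv] Thm. B₂; [GrossZagier1986] V.§2 (2.2); [GrossLMS1991] §2 Conj. 2.2, §4 (4.1), §5 Prop. 5.3, §11; [McCallumLMS1991] §5
Thm. 5.4; [MazurRubin2010] Prop. 3.3, Cor. 3.4, Lemma 3.5; [LawsonWuthrich2016] §7.1, §8; [Kramer1981] Thm. 1; [Milne1972ArithmeticAV] §1 Thm. 1;
[Miller2011LMS] Def. 1.1; [SilvermanAEC2009] III.1.4(b), X.4.2.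
-/

set_option autoImplicit false
set_option linter.dupNamespace false -- `Summit.<P>.<Sub>` repeats `BirchSwinnertonDyer` (D-0017)

noncomputable section

open scoped Classical

namespace Summit.BirchSwinnertonDyer.BirchSwinnertonDyer.Theorems.GenusSupplyPos.OfWallU2

open WeierstrassCurve NumberField IsDedekindDomain Field Literature.NumberTheory.EllipticCurves
  Literature.NumberTheory.GaloisRepresentations Literature.NumberTheory.EllipticCurves.ModularForms
  Literature.NumberTheory.EllipticCurves.RingClassField
open Summit.BirchSwinnertonDyer.BirchSwinnertonDyer.Theses.GenusKolyvaginAtTwo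
open Summit.BirchSwinnertonDyer.BirchSwinnertonDyer.Theses.ByReductionTypeAtTwo
  (GoodOrdinaryRankZeroAtTwo MultiplicativeRankZeroAtTwo SupersingularRankZeroAtTwo AdditiveRankZeroAtTwo)
open Summit.BirchSwinnertonDyer.BirchSwinnertonDyer.Theorems.GenusSupplyNarrow.Lossless
  (natCard_primaryComponent_sha_baseChange_two_eq_pow_of_bsdp_pair natCard_primaryComponent_sha_baseChange_two_eq_one_of_natCard_selmerGroup_eq_one)
open Summit.BirchSwinnertonDyer.BirchSwinnertonDyer.Theorems.GenusSupplyPos.PrimeFrame (genusPrimitiveSupplyAtTwoPosDiscShallow_of_items_of_selmerSplit_mixed)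

/-! ## §1 K4Pos BY NAME ⟸ WALL rows + U₂ + Q2 + PRINT (Theorems-side port of the pen's sorry-free LINE 33 v1.5 road) -/

/-- **K₄⁺ ON THE CUT ⟸ WALL row 1 + U₂ + Q2 + PRINT** (the pen's `onCut_of_wall_U2`, v1.1): the K₄⁺ frame binders with an odd multiplicative prime
`v`; the LEAD's leaf currency `PlusDescent.kFourPos_conclusion_iff_bsdp`, direction `.mpr`, fed with `BSD₂(E)` from the WALL rows (reduction-type
tetrachotomy at `2`, inlined — the statement of `GenusExact.Census.bsdp_rankZero_of_wallRows`) and `BSD₂(Wd)` from U₂ (the twin is non-CM by `j`,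
`RamifiedPairUpperBound.not_hasCM_of_smul_quadraticTwist_eq`).  CONDITIONAL on OPEN / print items; closes nothing.
[cite: McCallumLMS1991, §5 Thm. 5.4] [cite: GrossZagier1986, V.§2 (2.2)] [cite: Miller2011LMS, Def. 1.1] -/
theorem kFourPos_onCut_of_wallItems_of_minimalTwinBSDTwo (hOrd : GoodOrdinaryRankZeroAtTwo) (hMult : MultiplicativeRankZeroAtTwo)
    (hSS : SupersingularRankZeroAtTwo) (hAdd : AdditiveRankZeroAtTwo) (hTw : MinimalTwinBSDTwo) (hQ2 : KolyvaginRelationAtTwo)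
    (hGZ : GrossZagierAllLevels) (hGZK : MultPublishedInputsAtTwo) (hL : EntireLFunctionRat) (hMi : MilneAnyModel)
    (W : WeierstrassCurve ℚ) [W.IsElliptic] [W.IsGloballyMinimal] [NeZero (W.conductorNorm ℤ)]
    (hcm : ¬ W.HasCM) (hr0 : W.analyticRank = 0) (hρ : ∀ n : ℕ, 0 < n → W.HasSurjectiveModNGaloisRep ((2 : ℤ) ^ n))
    (hT : Odd W.tamagawaProduct) (hpos : 0 < W.Δ)
    (_h4 : Nat.card (W.selmerGroup 2) = 4 ∧ ∃ c ∈ (W.kummerSelmerStructure ((2 : ℕ) : ℤ)).selmerGroup,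
      galoisCohomology.localization (W.torsionGaloisModule ((2 : ℕ) : ℤ)) (Sum.inl Rat.infinitePlace) 1 c ≠ 0)
    (v : HeightOneSpectrum (𝓞 ℚ)) (h2v : ((2 : ℕ) : 𝓞 ℚ) ∉ v.asIdeal)
    (hNv : ((W.conductorNorm ℤ : ℕ) : 𝓞 ℚ) ∈ v.asIdeal) (hmult : W.HasMultiplicativeReductionAt v)
    (K : Type) [Field K] [NumberField K] (hIQ : IsImaginaryQuadratic K) (hodd : Odd (NumberField.discr K))
    (h3 : NumberField.discr K ≠ -3) (hHe : SatisfiesHeegnerHypothesis (W.conductorNorm ℤ) K)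
    (hsq1 : ¬ IsSquare ((NumberField.discr K : ℚ) * -|W.Δ|)) (hsq2 : ¬ IsSquare ((NumberField.discr K : ℚ) * (-(2 * |W.Δ|))))
    (Dt : ModularParametrizationData W (W.conductorNorm ℤ))
    (hopt : ∀ z ∈ Dt.L.lattice, ∃ w ∈ periodLattice Dt.f, z = (Dt.c : ℂ) * w) (hc : Odd Dt.c)
    (β : ℤ) (ι : K →+* ℂ) (d : KolyvaginHeegnerData Dt β ι 1) (hy : ¬ IsOfFinAddOrder d.derivedPoint)
    (M₀ : ℕ) (hdiv : ∃ Q : (W.baseChange (ringClassField K ι 1)).toAffine.Point, ((2 ^ M₀ : ℕ) : ℤ) • Q = d.derivedPoint)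
    (hndiv : ¬ ∃ Q : (W.baseChange (ringClassField K ι 1)).toAffine.Point, ((2 ^ (M₀ + 1) : ℕ) : ℤ) • Q = d.derivedPoint)
    (hM : 1 ≤ M₀)
    (Wd : WeierstrassCurve ℚ) [Wd.IsElliptic] [Wd.IsGloballyMinimal]
    (hWd : ∃ C : VariableChange ℚ, C • W.quadraticTwist (NumberField.discr K : ℚ) = Wd)
    (hrd : Wd.analyticRank = 1) (hSel : Nat.card (Wd.selmerGroup 2) = 2) (hDEF : padicValNat 2 Wd.tamagawaProduct = 0) :
    ∃ (n : ℕ) (d : KolyvaginHeegnerData Dt β ι n), Squarefree n ∧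
      (∀ ℓ ∈ n.primeFactors, Zhang2014.IsKolyvaginPrime (W.conductorNorm ℤ) W K 2 ℓ ∧ 2 ≤ Zhang2014.kolyvaginIndex W 2 ℓ ∧
        ∃ (v : HeightOneSpectrum (𝓞 ℚ)) (𝔓 : Ideal (absIntegers (𝓞 ℚ) ℚ)) (h : absoluteGaloisGroup ℚ),
          ((ℓ : ℕ) : 𝓞 ℚ) ∈ v.asIdeal ∧ 𝔓 ∈ v.primesAbove ∧ IsArithFrobAt (𝓞 ℚ) h 𝔓 ∧ ∃ u : W.geomTorsion ((2 : ℕ) : ℤ), h • u ≠ u) ∧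
      ¬ ∃ Q : (W.baseChange (ringClassField K ι n)).toAffine.Point, (2 : ℤ) • Q = d.derivedPoint := by
  haveI : Fact (Nat.Prime 2) := ⟨Nat.prime_two⟩
  have hD0 : (NumberField.discr K : ℚ) ≠ 0 := by exact_mod_cast NumberField.discr_ne_zero K
  -- `BSD₂(E)` from WALL row 1 by the reduction-type tetrachotomy at `2`
  have hBW : BSDp W 2 := by
    by_cases hg : W.HasGoodReductionAtPrime 2
    · by_cases hd : ((2 : ℕ) : ℤ) ∣ W.frobeniusTrace 2
      · exact hSS W hcm hr0 ⟨hg, hd⟩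
      · exact hOrd W hcm hr0 ⟨hg, hd⟩
    · by_cases hm : W.HasMultiplicativeReductionAtPrime 2
      · exact hMult W hcm hr0 hm
      · exact hAdd W hcm hr0 ⟨hg, hm⟩
  -- `BSD₂(Wd)` from U₂
  obtain ⟨Cd, hCd⟩ := hWd
  have hcmd : ¬ Wd.HasCM := RamifiedPairUpperBound.not_hasCM_of_smul_quadraticTwist_eq hD0 hCd hcm
  have hBd : BSDp Wd 2 := hTw Wd hcmd hrd hSel
  exact (Summit.BirchSwinnertonDyer.BirchSwinnertonDyer.Theorems.GenusExact.PlusDescent.kFourPos_conclusion_iff_bsdp hGZ hL hGZK hMi hQ2 W hcm hr0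
    hρ hT hpos v h2v hNv hmult K hIQ hodd h3 hHe hsq1 hsq2 Dt hopt hc β ι d hy M₀ hM hdiv hndiv Wd ⟨Cd, hCd⟩ hrd hSel hDEF hBd).mpr hBW

/-- **The K₄⁺ SHAPE off the cut from ONE sharp Selmer class, modulo Q2 and (NPh_K)** (the pen's `kFour_shape_offCut_of_nonPhantom`, v1.2; proof =
the LEAD's master `PlusDescent.exists_transpositionDeep_primitive_of_two_pow_pred_smul_ne_zero_of_nonPhantom` + bookkeeping).
[cite: McCallumLMS1991, §5 Thm. 5.4] [cite: Kolyvagin1989Izv, Thm. B₂] -/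
theorem kFourPos_shape_offCut_of_nonPhantom (hQ2 : KolyvaginRelationAtTwo)
    (W : WeierstrassCurve ℚ) [W.IsElliptic] [W.IsGloballyMinimal] [NeZero (W.conductorNorm ℤ)] (hcm : ¬ W.HasCM)
    (hT : Odd W.tamagawaProduct)
    (K : Type) [Field K] [NumberField K] (hIQ : IsImaginaryQuadratic K) (hodd : Odd (NumberField.discr K))
    (h3 : NumberField.discr K ≠ -3) (hHe : SatisfiesHeegnerHypothesis (W.conductorNorm ℤ) K)
    (hρ : ∀ n : ℕ, 0 < n → W.HasSurjectiveModNGaloisRep ((2 : ℤ) ^ n))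
    (hNPh : ∀ (L : ℕ), 1 ≤ L → ∀ z : galH1Torsion (W.baseChange K) ((2 ^ L : ℕ) : ℤ),
      (∀ ρ' ∈ torsionFixing (W.baseChange K) ((2 ^ L : ℕ) : ℤ), h1Eval (W.baseChange K) ((2 ^ L : ℕ) : ℤ) z ρ' = 0) →
      (∀ w : HeightOneSpectrum (𝓞 K), z ∈ selmerLocalKer (W.baseChange K) (w.adicCompletion K) ((2 ^ L : ℕ) : ℤ)) → z = 0)
    (Dt : ModularParametrizationData W (W.conductorNorm ℤ)) (β : ℤ) (ι : K →+* ℂ) (d₁ : KolyvaginHeegnerData Dt β ι 1) (M₀ : ℕ)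
    (hndiv : ¬ ∃ Q : (W.baseChange (ringClassField K ι 1)).toAffine.Point, ((2 ^ (M₀ + 1) : ℕ) : ℤ) • Q = d₁.derivedPoint)
    (hw1 : W.rootNumber = 1)
    (hsharp : ∃ (M : ℕ) (s₀ : galH1Torsion W ((2 ^ M : ℕ) : ℤ)), s₀ ∈ selmerGroup W ((2 ^ M : ℕ) : ℤ) ∧ ((2 ^ (M₀ - 1) : ℕ) : ℤ) • s₀ ≠ 0) :
    ∃ (n : ℕ) (d : KolyvaginHeegnerData Dt β ι n), Squarefree n ∧
      (∀ ℓ ∈ n.primeFactors, Zhang2014.IsKolyvaginPrime (W.conductorNorm ℤ) W K 2 ℓ ∧ 2 ≤ Zhang2014.kolyvaginIndex W 2 ℓ ∧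
        ∃ (v : HeightOneSpectrum (𝓞 ℚ)) (𝔓 : Ideal (absIntegers (𝓞 ℚ) ℚ)) (h : absoluteGaloisGroup ℚ),
          ((ℓ : ℕ) : 𝓞 ℚ) ∈ v.asIdeal ∧ 𝔓 ∈ v.primesAbove ∧ IsArithFrobAt (𝓞 ℚ) h 𝔓 ∧ ∃ u : W.geomTorsion ((2 : ℕ) : ℤ), h • u ≠ u) ∧
      ¬ ∃ Q : (W.baseChange (ringClassField K ι n)).toAffine.Point, (2 : ℤ) • Q = d.derivedPoint := by
  obtain ⟨M, s₀, hs₀, hne⟩ := hsharp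
  obtain ⟨ℓ, d, hkol, hidx, ⟨v', 𝔓, h, c₀, hℓv, h𝔓, hh, -, -, hhu, -⟩, -, -, hwit⟩ :=
    Summit.BirchSwinnertonDyer.BirchSwinnertonDyer.Theorems.GenusExact.PlusDescent.exists_transpositionDeep_primitive_of_two_pow_pred_smul_ne_zero_of_nonPhantom
      hQ2 W hcm hT K hIQ hodd h3 hHe hρ hNPh Dt β ι d₁ M₀ hndiv hw1 M s₀ hs₀ hne
  have hℓp : ℓ.Prime := hkol.1
  refine ⟨1 * ℓ, d, by rw [one_mul]; exact hℓp.squarefree, fun q hq ↦ ?_, hwit⟩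
  rw [one_mul, hℓp.primeFactors, Finset.mem_singleton] at hq
  subst hq
  exact ⟨hkol, hidx, v', 𝔓, h, hℓv, h𝔓, hh, hhu⟩

/-- **K₄⁺ AT AN OFF-CUT FRAME ⟸ WALL row 1 + U₂ + Q2 + PRINT + (NPh_K)** (the pen's `offCut_of_wall_U2_of_nonPhantom`, v1.2): `BSD₂(E)` (WALL) and
`BSD₂(Wd)` (U₂) give `#Ш(E/K)[2^∞] = 4^(M₀)` (gk2-p5 g34's pair ledger), hence a class of order `2^(M₀)` in `Ш(E/ℚ)` (LEAD), hence a sharp Selmer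
class (`Sel_(2^k)(E/ℚ) ↠ Ш(E/ℚ)[2^k]`), and the shape theorem concludes.  CONDITIONAL; closes nothing.
[cite: GrossZagier1986, V.§2 (2.2)] [cite: McCallumLMS1991, §5 Thm. 5.4] [cite: LawsonWuthrich2016, §7.1] -/
theorem kFourPos_offCut_of_wallItems_of_minimalTwinBSDTwo_of_nonPhantom (hOrd : GoodOrdinaryRankZeroAtTwo) (hMult : MultiplicativeRankZeroAtTwo)
    (hSS : SupersingularRankZeroAtTwo) (hAdd : AdditiveRankZeroAtTwo) (hTw : MinimalTwinBSDTwo) (hQ2 : KolyvaginRelationAtTwo)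
    (hGZ : GrossZagierAllLevels) (hGZK : MultPublishedInputsAtTwo) (hL : EntireLFunctionRat) (hMi : MilneAnyModel)
    (W : WeierstrassCurve ℚ) [W.IsElliptic] [W.IsGloballyMinimal] [NeZero (W.conductorNorm ℤ)]
    (hcm : ¬ W.HasCM) (hr0 : W.analyticRank = 0) (hρ : ∀ n : ℕ, 0 < n → W.HasSurjectiveModNGaloisRep ((2 : ℤ) ^ n))
    (hT : Odd W.tamagawaProduct) (hpos : 0 < W.Δ)
    (K : Type) [Field K] [NumberField K] (hIQ : IsImaginaryQuadratic K) (hodd : Odd (NumberField.discr K))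
    (h3 : NumberField.discr K ≠ -3) (hHe : SatisfiesHeegnerHypothesis (W.conductorNorm ℤ) K)
    (Dt : ModularParametrizationData W (W.conductorNorm ℤ)) (hc : Odd Dt.c)
    (β : ℤ) (ι : K →+* ℂ) (d : KolyvaginHeegnerData Dt β ι 1) (hy : ¬ IsOfFinAddOrder d.derivedPoint)
    (M₀ : ℕ) (hdiv : ∃ Q : (W.baseChange (ringClassField K ι 1)).toAffine.Point, ((2 ^ M₀ : ℕ) : ℤ) • Q = d.derivedPoint)
    (hndiv : ¬ ∃ Q : (W.baseChange (ringClassField K ι 1)).toAffine.Point, ((2 ^ (M₀ + 1) : ℕ) : ℤ) • Q = d.derivedPoint)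
    (hM : 1 ≤ M₀)
    (Wd : WeierstrassCurve ℚ) [Wd.IsElliptic] [Wd.IsGloballyMinimal]
    (hWd : ∃ C : VariableChange ℚ, C • W.quadraticTwist (NumberField.discr K : ℚ) = Wd)
    (hrd : Wd.analyticRank = 1) (hSel : Nat.card (Wd.selmerGroup 2) = 2) (hDEF : padicValNat 2 Wd.tamagawaProduct = 0)
    (hNPh : ∀ (L : ℕ), 1 ≤ L → ∀ z : galH1Torsion (W.baseChange K) ((2 ^ L : ℕ) : ℤ),
      (∀ ρ' ∈ torsionFixing (W.baseChange K) ((2 ^ L : ℕ) : ℤ), h1Eval (W.baseChange K) ((2 ^ L : ℕ) : ℤ) z ρ' = 0) →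
      (∀ w : HeightOneSpectrum (𝓞 K), z ∈ selmerLocalKer (W.baseChange K) (w.adicCompletion K) ((2 ^ L : ℕ) : ℤ)) → z = 0) :
    ∃ (n : ℕ) (d : KolyvaginHeegnerData Dt β ι n), Squarefree n ∧
      (∀ ℓ ∈ n.primeFactors, Zhang2014.IsKolyvaginPrime (W.conductorNorm ℤ) W K 2 ℓ ∧ 2 ≤ Zhang2014.kolyvaginIndex W 2 ℓ ∧
        ∃ (v : HeightOneSpectrum (𝓞 ℚ)) (𝔓 : Ideal (absIntegers (𝓞 ℚ) ℚ)) (h : absoluteGaloisGroup ℚ),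
          ((ℓ : ℕ) : 𝓞 ℚ) ∈ v.asIdeal ∧ 𝔓 ∈ v.primesAbove ∧ IsArithFrobAt (𝓞 ℚ) h 𝔓 ∧ ∃ u : W.geomTorsion ((2 : ℕ) : ℤ), h • u ≠ u) ∧
      ¬ ∃ Q : (W.baseChange (ringClassField K ι n)).toAffine.Point, (2 : ℤ) • Q = d.derivedPoint := by
  haveI : Fact (Nat.Prime 2) := ⟨Nat.prime_two⟩
  have hD0 : (NumberField.discr K : ℚ) ≠ 0 := by exact_mod_cast NumberField.discr_ne_zero K
  have hs2 : W.HasSurjectiveModNGaloisRep 2 := by simpa using hρ 1 one_pos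
  have hw : W.rootNumber = 1 :=
    (Literature.Barriers.BirchSwinnertonDyer.even_analyticRank_iff_of_isNewformOf_conductorLevel Dt.isNewformOf).mp
      (by rw [hr0]; exact Even.zero)
  have hrk0 : W.mordellWeilRank = 0 := by rw [(hGZK W (by rw [hr0]; exact zero_le_one)).1, hr0]
  -- `BSD₂(E)` from WALL row 1, `BSD₂(Wd)` from U₂
  have hBW : BSDp W 2 := by
    by_cases hg : W.HasGoodReductionAtPrime 2
    · by_cases hd : ((2 : ℕ) : ℤ) ∣ W.frobeniusTrace 2
      · exact hSS W hcm hr0 ⟨hg, hd⟩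
      · exact hOrd W hcm hr0 ⟨hg, hd⟩
    · by_cases hm : W.HasMultiplicativeReductionAtPrime 2
      · exact hMult W hcm hr0 hm
      · exact hAdd W hcm hr0 ⟨hg, hm⟩
  obtain ⟨Cd, hCd⟩ := hWd
  have hcmd : ¬ Wd.HasCM := RamifiedPairUpperBound.not_hasCM_of_smul_quadraticTwist_eq hD0 hCd hcm
  have hBd : BSDp Wd 2 := hTw Wd hcmd hrd hSel
  have hpow :=
    Summit.BirchSwinnertonDyer.BirchSwinnertonDyer.Theorems.GenusSupplyNarrow.Lossless.natCard_primaryComponent_sha_baseChange_two_eq_pow_of_bsdp_pair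
      hGZ hL hGZK hMi W hs2 hT hr0 K hIQ hodd h3 hHe Dt hc β ι d M₀ hdiv hndiv Wd ⟨Cd, hCd⟩ hrd hBW hBd
  obtain ⟨k, a, ha, hka, hne⟩ :=
    Summit.BirchSwinnertonDyer.BirchSwinnertonDyer.Theorems.GenusExact.PlusDescent.exists_mem_sha_two_pow_pred_smul_ne_zero_of_natCard_eq_pow
      W K hT hIQ hodd hHe hs2 Dt β ι d hy M₀ hM hndiv hw hrk0 Wd ⟨Cd, hCd⟩ hSel (Or.inr ⟨hpos, hDEF⟩) hpow
  -- `Sel_(2^k)(E/ℚ) ↠ Ш(E/ℚ)[2^k]` (the LEAD's step, verbatim)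
  rcases Nat.eq_zero_or_pos k with rfl | hkpos
  · rw [pow_zero, Nat.cast_one, one_zsmul] at hka
    exact (hne (by rw [hka, zsmul_zero])).elim
  · have hn : ((2 ^ k : ℕ) : ℤ) ≠ 0 := by positivity
    have hmem : a ∈ W.sha ⊓ AddSubgroup.torsionBy W.galH1 ((2 ^ k : ℕ) : ℤ) :=
      AddSubgroup.mem_inf.mpr ⟨ha, by change ((2 ^ k : ℕ) : ℤ) • a = 0; exact hka⟩
    rw [← WeierstrassCurve.map_torsionH1ToH1_selmerGroup_holds W hn] at hmem
    obtain ⟨x, hx, rfl⟩ := AddSubgroup.mem_map.mp hmem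
    have hne' : ((2 ^ (M₀ - 1) : ℕ) : ℤ) • x ≠ 0 := fun h ↦ hne (by rw [← map_zsmul, h, map_zero])
    exact kFourPos_shape_offCut_of_nonPhantom hQ2 W hcm hT K hIQ hodd h3 hHe hρ hNPh Dt β ι d M₀ hndiv hw ⟨k, x, hx, hne'⟩

/-- ★ **K4Pos (stmt-BirchSwinnertonDyer-31469) ⟸ WALL rows 19095–19098 + U₂ (22985) + Q2 (24880) + GZ/GZK/L/Milne, BY NAME** — Theorems-side port
of the pen's sorry-free LINE 33 v1.5 road `K4Pos_of_wall_U2_nonPhantom`: on the cut §1's first theorem; off the cut the second with (NPh_K) DISCHARGED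
by gk2-p4 g32's real witness `Lw2PhantomExclusion.RealWitness.offCutNonPhantomAtTwo_of_twoSplit` (`Δ > 0`: the Lawson–Wuthrich class is never
Kummer at `∞`, and the K₄⁺ real clause forwards the witness to a finite prime).  CONDITIONAL on OPEN / print items; closes nothing.
[cite: LawsonWuthrich2016, §7.1, §8] [cite: MazurRubin2010, Lemma 3.2] [cite: McCallumLMS1991, §5 Thm. 5.4] [cite: GrossZagier1986, V.§2 (2.2)] -/
theorem k4Pos_of_wallItems_of_minimalTwinBSDTwo_of_kolyvaginRelation (hOrd : GoodOrdinaryRankZeroAtTwo) (hMult : MultiplicativeRankZeroAtTwo)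
    (hSS : SupersingularRankZeroAtTwo) (hAdd : AdditiveRankZeroAtTwo) (hTw : MinimalTwinBSDTwo) (hQ2 : KolyvaginRelationAtTwo)
    (hGZ : GrossZagierAllLevels) (hGZK : MultPublishedInputsAtTwo) (hL : EntireLFunctionRat) (hMi : MilneAnyModel) : K4Pos := by
  intro W _ _ _ hcm hr0 hρ hT hpos h4 K _ _ hIQ hodd h3 hHe hsq1 hsq2 ℓ₀ hℓ₀ hdK h2K Dt hopt hc β ι d₁ hy M₀ hdiv hndiv hM₀ Wd _ _ hWd
    hrd hSel hDEF
  by_cases hcut : ∃ v : HeightOneSpectrum (𝓞 ℚ), ((2 : ℕ) : 𝓞 ℚ) ∉ v.asIdeal ∧ ((W.conductorNorm ℤ : ℕ) : 𝓞 ℚ) ∈ v.asIdeal ∧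
      W.HasMultiplicativeReductionAt v
  · obtain ⟨v, h2v, hNv, hmult⟩ := hcut
    exact kFourPos_onCut_of_wallItems_of_minimalTwinBSDTwo hOrd hMult hSS hAdd hTw hQ2 hGZ hGZK hL hMi W hcm hr0 hρ hT hpos h4 v h2v hNv hmult
      K hIQ hodd h3 hHe hsq1 hsq2 Dt hopt hc β ι d₁ hy M₀ hdiv hndiv hM₀ Wd hWd hrd hSel hDEF
  · exact kFourPos_offCut_of_wallItems_of_minimalTwinBSDTwo_of_nonPhantom hOrd hMult hSS hAdd hTw hQ2 hGZ hGZK hL hMi W hcm hr0 hρ hT hpos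
      K hIQ hodd h3 hHe Dt hc β ι d₁ hy M₀ hdiv hndiv hM₀ Wd hWd hrd hSel hDEF
      (fun L hLge z hz hw ↦
        Summit.BirchSwinnertonDyer.BirchSwinnertonDyer.Theorems.GenusExact.Lw2PhantomExclusion.RealWitness.offCutNonPhantomAtTwo_of_twoSplit
          W hcm hr0 hρ hT hpos h4 hcut K hIQ hodd h3 hHe hsq1 hsq2 h2K L hLge z hz (fun w _ ↦ hw w))

/-! ## §2 The `Δ > 0` supply crux 25504 BY NAME from existing items only -/

/-- **K1Pos (31468) ⟸ WALL rows + U₂ + PRINT, BY NAME** — the statement of this seat's `GenusSupplyNarrow.Lossless.OfWallU2.k1Pos_of_wallItems_of_minimalTwinBSDTwo`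
(p791715), re-derived here along a route-independent import chain (that module imports a route file; this one must stay importable): gk2-p5 g34's
pair ledger `…_eq_pow_of_bsdp_pair` (`#Ш(E/K)[2^∞] = 4^{M₀}` from `BSD₂(E)` = WALL and `BSD₂(Wd)` = U₂) against `…_eq_one_of_natCard_selmerGroup_eq_one`
(`= 1` on `#Sel₂(E) = 1`) forces `M₀ = 0`.  CONDITIONAL on OPEN / print items; closes nothing.
[cite: GrossZagier1986, V.§2 (2.2)] [cite: Kramer1981, Thm. 1] [cite: Milne1972ArithmeticAV, §1 Thm. 1] -/
theorem k1Pos_of_wallItems_of_minimalTwinBSDTwo' (hOrd : GoodOrdinaryRankZeroAtTwo) (hMult : MultiplicativeRankZeroAtTwo)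
    (hSS : SupersingularRankZeroAtTwo) (hAdd : AdditiveRankZeroAtTwo) (hTw : MinimalTwinBSDTwo)
    (hGZ : GrossZagierAllLevels) (hGZK : MultPublishedInputsAtTwo) (hL : EntireLFunctionRat) (hMi : MilneAnyModel) : K1Pos := by
  intro W _ _ _ hcm hr0 hρ hT hpos h1 K _ _ hIQ hodd h3 hHe _hsq1 _hsq2 Dt _hoptDt hc β ι d₁ hy M₀ hdiv hndiv hM Wd _ _ hWd hrd hSel hDEF
  have hρ2 : W.HasSurjectiveModNGaloisRep 2 := by simpa using hρ 1 one_pos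
  have hD0 : (NumberField.discr K : ℚ) ≠ 0 := by exact_mod_cast NumberField.discr_ne_zero K
  have hBW : BSDp W 2 := by
    by_cases hg : W.HasGoodReductionAtPrime 2
    · by_cases hd : ((2 : ℕ) : ℤ) ∣ W.frobeniusTrace 2
      · exact hSS W hcm hr0 ⟨hg, hd⟩
      · exact hOrd W hcm hr0 ⟨hg, hd⟩
    · by_cases hm : W.HasMultiplicativeReductionAtPrime 2
      · exact hMult W hcm hr0 hm
      · exact hAdd W hcm hr0 ⟨hg, hm⟩
  obtain ⟨Cd, hCd⟩ := hWd
  have hcmd : ¬ Wd.HasCM := RamifiedPairUpperBound.not_hasCM_of_smul_quadraticTwist_eq hD0 hCd hcm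
  have hBd : BSDp Wd 2 := hTw Wd hcmd hrd hSel
  have hpow := natCard_primaryComponent_sha_baseChange_two_eq_pow_of_bsdp_pair hGZ hL hGZK hMi W hρ2 hT hr0 K hIQ hodd h3 hHe Dt hc β ι d₁ M₀
    hdiv hndiv Wd ⟨Cd, hCd⟩ hrd hBW hBd
  have hone := natCard_primaryComponent_sha_baseChange_two_eq_one_of_natCard_selmerGroup_eq_one W K hT hr0 h1 hIQ hodd hHe hρ2 Dt β ι d₁
    hy M₀ hndiv Wd ⟨Cd, hCd⟩ hSel (Or.inr ⟨hpos, hDEF⟩)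
  rw [hone] at hpow
  have h0 : 2 * M₀ = 0 := by
    rcases (Nat.pow_eq_one.mp hpow.symm) with h | h
    · exact absurd h (by norm_num)
    · exact h
  omega


/-- ★★ **`GenusPrimitiveSupplyAtTwoPosDiscShallow` (stmt-BirchSwinnertonDyer-25504, the `Δ > 0` supply crux, binder `hP` of `closes`) ⟸ EXISTING ITEMS
ONLY, BY NAME**: `GrossZagierAllLevels` (24148), `ModularityExistsNewform` (19382), `TwoParityDD` (23327), `RankOneTwoConverse` (19220),
`RankOneTwoConverseOffSemistableAtTwo` (24948), WALL rows 19095–19098 (route ByReductionTypeAtTwo), `MinimalTwinBSDTwo` (22985), `KolyvaginRelationAtTwo`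
(24880), `MultPublishedInputsAtTwo` (19921), `EntireLFunctionRat` (19273), `MilneAnyModel` (24149).  Proof: gk2-p2's mixed-frame K-itemisation
`GenusSupplyPos.PrimeFrame.genusPrimitiveSupplyAtTwoPosDiscShallow_of_items_of_selmerSplit_mixed` (p766811) fed with K1Pos (`…OfWallU2.k1Pos_of_wallItems_…`,
p791715) and K4Pos (§1).  So the `Δ > 0` supply crux carries NO K-input beyond the route's other items.  CONDITIONAL on those OPEN / print items;
proves nothing about BSD; closes nothing.
[cite: GrossZagier1986, Thm. I.6.3, V.§2 (2.2)] [cite: GrossLMS1991, §4 (4.1), §11] [cite: MazurRubin2010, Prop. 3.3, Cor. 3.4] [cite: Miller2011LMS, Def. 1.1] -/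
theorem genusPrimitiveSupplyAtTwoPosDiscShallow_of_items_of_wall_U2_Q2
    (hGZ : GrossZagierAllLevels) (hmod : ModularityExistsNewform) (hpar : TwoParityDD) (hconv : RankOneTwoConverse)
    (hconv' : RankOneTwoConverseOffSemistableAtTwo)
    (hOrd : GoodOrdinaryRankZeroAtTwo) (hMult : MultiplicativeRankZeroAtTwo) (hSS : SupersingularRankZeroAtTwo) (hAdd : AdditiveRankZeroAtTwo)
    (hTw : MinimalTwinBSDTwo) (hQ2 : KolyvaginRelationAtTwo)
    (hGZK : MultPublishedInputsAtTwo) (hL : EntireLFunctionRat) (hMi : MilneAnyModel) :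
    GenusPrimitiveSupplyAtTwoPosDiscShallow :=
  genusPrimitiveSupplyAtTwoPosDiscShallow_of_items_of_selmerSplit_mixed hGZ hmod hpar hconv hconv'
    (k1Pos_of_wallItems_of_minimalTwinBSDTwo' hOrd hMult hSS hAdd hTw hGZ hGZK hL hMi)
    (k4Pos_of_wallItems_of_minimalTwinBSDTwo_of_kolyvaginRelation hOrd hMult hSS hAdd hTw hQ2 hGZ hGZK hL hMi)

end Summit.BirchSwinnertonDyer.BirchSwinnertonDyer.Theorems.GenusSupplyPos.OfWallU2

end
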